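import Literature.AlgebraicGeometry.HodgeTheory.MaxRationalSubHodgeStructureKunnethLinePieces
import Literature.AlgebraicGeometry.HodgeTheory.GeneralHodgePropertyOfVanishingHodgeNumbers
import HarnessLib

/-!
# Künneth pieces of given factor coniveau; `GHC(X × Y, k, 1)` from the factors; surfaces with `p_g = 0` times
# curves satisfy Grothendieck's amended `GHC` in every bidegree

Family `hodge`, layer `Literature/AlgebraicGeometry/HodgeTheory`; lane `lit-hodgefound` (Track 2 foundations,
Layer A1/A4). THEOREMS ONLY (no definition, no named fact; D-0026). Sequel of
`MaxRationalSubHodgeStructureKunnethDecomposition` (`GHC(X × Y, k, r)` holds iff every Künneth component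
`max(X × Y, k, r) ∩ (Hⁱ(X) ⊗ Hʲ(Y))` lies in `Nʳ`; the extreme components are settled by `GHC(X, k, r)`,
`GHC(Y, k, r)`; `Hⁱ(X) ⊗ Hʲ(Y) ⊆ N^{(i−n)+(j−m)}` for free) and `MaxRationalSubHodgeStructureKunnethLinePieces`
(`GHC(X × C, k + 2, r + 1) ⟺ GHC(X, k + 2, r + 1) ∧ GHC(X, k, r) ∧` the `H^{k+1}(X) ⊗ H¹(C)`-component, `C` a curve).

Sources, VERBATIM. A. Grothendieck, *Hodge's general conjecture is false for trivial reasons*, Topology 8 (1969),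
p. 300: the amended conjecture concerns «the largest sub-space of [`Fʳ Hᵏ ∩ Hᵏ(X, ℚ)`], generating a subspace of
`Hᵏ(X^an, ℂ)` which is a sub-Hodge structure» — his counter-example to Hodge's original statement lives in the
Künneth piece `H²(E × E) ⊗ H¹(E)` of `H³` of the cube of an elliptic curve, at LEVEL `r = 1`. C. Voisin, *Hodge and
generalized Hodge conjectures, coniveau and algebraic cycles*, J. Open Math. Probl. 1 (2025), Introduction (journal
p. 17): «There is an obvious restriction satisfied by such classes [classes of geometric coniveau `c`], namely that
they are “of Hodge coniveau `c`” […] According to this conjecture, the vanishing of the spaces `H^{p,q}(X)` for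
`p < c` or `q < c` implies that the whole cohomology `Hᵏ(X, ℚ)` is of geometric coniveau `≥ c`», and §4.1 (ii)
«The set of degree `k` cohomology classes of geometric coniveau `≥ c` is a Hodge substructure of `Hᵏ(X, ℚ)`».
J. Murre, *Algebraic cycles and algebraic aspects of cohomology and K-theory* (Torino 1993, LNM 1594), §5.8.1: for a
threefold with `h^{3,0} = 0` Grothendieck's conjecture is the statement `N¹ H³(X) = H³(X)` (the tree's
`generalHodgePropertyFor_three_one_iff_of_hodgeNumber_three_zero`, `generalHodgePropertyFor_of_dim_three`).
C. Voisin, *Hodge Theory and Complex Algebraic Geometry I* (CUP 2002), §11.3.3 Thm. 11.38/11.40 (Künneth; `Hᵏ(X) ⊗ Hˡ(Y)`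
is a sub-Hodge structure of `H^{k+l}(X × Y)`).

## What is proved (`X`, `Y` smooth projective over `ℂ` of dimensions `n`, `m`)

* §1 `kunnethPiece_le_supportedClasses_of_eq_top_left/_right` — if `Nᵃ Hⁱ(X) = Hⁱ(X)` then
  `Hⁱ(X) ⊗ Hʲ(Y) ⊆ N^{a+(j−m)} Hᵏ((X ⊗ Y)(ℂ); ℂ)` (cross products of supported classes,
  `cupProduct_map_fst_map_snd_mem_supportedClasses`, the second factor contributing its free coniveau `j − m`),
  and symmetrically; the two-sided form `Nᵃ ⊗ Nᵇ ⊆ N^{a+b}` is the tree's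
  `kunnethPiece_le_supportedClasses_add_of_eq_top` (`KunnethComponentsDiagonalAlgebraicPart`).
* §2 **`generalHodgePropertyFor_tensor_level_one`** — `GHC(X × Y, k, 1)` holds as soon as `GHC(X, k, 1)`,
  `GHC(Y, k, 1)` hold and every INTERIOR piece `Hⁱ(X) ⊗ Hʲ(Y)` (`i, j > 0`, `i ≤ n`, `j ≤ m` — the others are free)
  has `N¹ Hⁱ(X) = Hⁱ(X)`, or `N¹ Hʲ(Y) = Hʲ(Y)`, or its component of `max(X × Y, k, 1)` inside `N¹`;
  **`generalHodgePropertyFor_tensor_level_one_iff_of_forall`** — the equivalence with `GHC(X, k, 1) ∧ GHC(Y, k, 1)`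
  when every interior piece has a factor of coniveau `1`.
* §3 **`generalHodgePropertyFor_surface_tensor_level_one_iff`** — for a surface `S` with `H¹(S(ℂ); ℂ) = 0` and
  `N¹ H²(S) = H²(S)` (e.g. `q = p_g = 0`): `GHC(S × Y, k, 1) ⟺ GHC(Y, k, 1)` for every smooth projective `Y`.
* §4 Curves: **`generalHodgePropertyFor_tensor_curve_middle_one_iff`** — for `X` of dimension `d + 1` and a curve
  `C`, `GHC(X × C, d + 2, 1) ⟺ max(X × C, d + 2, 1) ∩ (H^{d+1}(X) ⊗ H¹(C)) ⊆ N¹` (the only piece not settled for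
  free or by the known `GHC(X, d + 2, 1)`, `GHC(X, d, 0)`), automatic when `N¹ H^{d+1}(X) = H^{d+1}(X)`
  (`…_of_supportedClasses_eq_top`); hence **`generalHodgePropertyFor_surface_tensor_curve`** — for a smooth
  projective SURFACE `S` WITH `N¹ H²(S) = H²(S)` — equivalently (`generalHodgePropertyFor_two_one`, Lefschetz `(1,1)`,
  with `GeneralHodgePropertyFor.supportedClasses_eq_top_of_hodgeNumber_eq_zero`) `h^{0,2}(S) = 0`, i.e. `p_g(S) = 0`
  — AND EVERY SMOOTH PROJECTIVE CURVE `C`, GROTHENDIECK'S AMENDED `GHC(S × C, i, r)` HOLDS IN EVERY BIDEGREE `(i, r)`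
  (the threefold window reduces to `(3, 1)`, `generalHodgePropertyFor_of_dim_three`;
  `forall_generalHodgePropertyFor_surface_tensor_curve_of_hodgeNumber_eq_zero`).

## References

* [GrothendieckTopology1969] A. Grothendieck, Hodge's general conjecture is false for trivial reasons, Topology 8
  (1969) 299–303, p. 300 and §1.
* [Voisin2025] C. Voisin, Hodge and generalized Hodge conjectures, coniveau and algebraic cycles, J. Open Math.
  Probl. 1 (2025), Introduction (journal p. 17), §4.1 Def. 4.1 and (ii).
* [MurreTorino1994] J. P. Murre, Algebraic cycles and algebraic aspects of cohomology and K-theory, in: Algebraic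
  Cycles and Hodge Theory (Torino 1993), LNM 1594 (1994), §5.8.1.
* [VoisinHodgeI2002] C. Voisin, Hodge Theory and Complex Algebraic Geometry I (CUP 2002), §11.3.3 Thm. 11.38,
  Thm. 11.40 and p. 287.
* [Arapura2006] D. Arapura, Motivation for Hodge cycles, Adv. Math. 207 (2006), §4 Lemma 4.2.
-/

noncomputable section

open CategoryTheory AlgebraicGeometry MonoidalCategory CartesianMonoidalCategory Finset
open Literature.AlgebraicTopology.SingularHomology
open Literature.Geometry.Kaehler
open Literature.AlgebraicGeometry.Motives (IsSmoothProjective ComplexPoints)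

namespace Literature.AlgebraicGeometry.HodgeTheory

variable {n m : ℕ} {X Y : Motives.SchemeOver ℂ} {i j k : ℕ}

/-! ### §1 Künneth pieces of given factor coniveau -/

/-- **`Nᵃ Hⁱ(X) = Hⁱ(X)` gives `Hⁱ(X) ⊗ Hʲ(Y) ⊆ N^{a+(j−m)} Hᵏ(X ⊗ Y)`** (the second factor contributes its free
coniveau `j − m`, `mem_supportedClasses_sub_dim`). [cite: Voisin2025, §4.1 Def. 4.1 and §4.3 (first paragraph)]
[cite: GrothendieckTopology1969, §1] -/
theorem kunnethPiece_le_supportedClasses_of_eq_top_left (hX : IsSmoothProjective n X) (hY : IsSmoothProjective m Y)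
    (hk : i + j = k) {a : ℕ} (ha : supportedClasses X i a = ⊤) :
    kunnethPiece X Y hk ≤ supportedClasses (X ⊗ Y) k (a + (j - m)) := by
  refine Submodule.span_le.2 ?_
  rintro _ ⟨x, y, rfl⟩
  exact cupProduct_map_fst_map_snd_mem_supportedClasses hX hY hk (by rw [ha]; exact Submodule.mem_top)
    (mem_supportedClasses_sub_dim hY y)

/-- **`Nᵇ Hʲ(Y) = Hʲ(Y)` gives `Hⁱ(X) ⊗ Hʲ(Y) ⊆ N^{(i−n)+b} Hᵏ(X ⊗ Y)`.** [cite: Voisin2025, §4.1 Def. 4.1 and §4.3 (first paragraph)]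
[cite: GrothendieckTopology1969, §1] -/
theorem kunnethPiece_le_supportedClasses_of_eq_top_right (hX : IsSmoothProjective n X) (hY : IsSmoothProjective m Y)
    (hk : i + j = k) {b : ℕ} (hb : supportedClasses Y j b = ⊤) :
    kunnethPiece X Y hk ≤ supportedClasses (X ⊗ Y) k ((i - n) + b) := by
  refine Submodule.span_le.2 ?_
  rintro _ ⟨x, y, rfl⟩
  exact cupProduct_map_fst_map_snd_mem_supportedClasses hX hY hk (mem_supportedClasses_sub_dim hX x)
    (by rw [hb]; exact Submodule.mem_top)

/-! ### §2 `GHC(X × Y, k, 1)` from the factors -/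

/-- **`GHC(X × Y, k, 1)` FROM THE FACTORS**: Grothendieck's amended conjecture at level `1` holds for `Hᵏ(X × Y)`
as soon as `GHC(X, k, 1)` and `GHC(Y, k, 1)` hold (they settle the extreme pieces `Hᵏ(X) ⊗ H⁰(Y)`, `H⁰(X) ⊗ Hᵏ(Y)`)
and every interior piece `Hⁱ(X) ⊗ Hʲ(Y)`, `i, j > 0`, `i ≤ n`, `j ≤ m` (the pieces with `i > n` or `j > m` have
coniveau `≥ 1` for free) has a factor of geometric coniveau `1` — `N¹ Hⁱ(X) = Hⁱ(X)` or `N¹ Hʲ(Y) = Hʲ(Y)` — or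
its component of `max(X × Y, k, 1)` inside `N¹`. [cite: GrothendieckTopology1969, p. 300]
[cite: Voisin2025, Introduction (journal p. 17) and §4.1] [cite: VoisinHodgeI2002, §11.3.3 Thm. 11.38 and p. 287] -/
theorem generalHodgePropertyFor_tensor_level_one (hX : IsSmoothProjective n X) (hY : IsSmoothProjective m Y)
    (C : HodgeModel (n + m) (X ⊗ Y)) {k : ℕ} (h₁ : GeneralHodgePropertyFor n X k 1)
    (h₂ : GeneralHodgePropertyFor m Y k 1)
    (h : ∀ (i j : ℕ) (hk : i + j = k), 0 < i → 0 < j → i ≤ n → j ≤ m →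
      supportedClasses X i 1 = ⊤ ∨ supportedClasses Y j 1 = ⊤ ∨
        C.maxRatSubHodgeInFilt k 1 ⊓ kunnethPiece X Y hk ≤ supportedClasses (X ⊗ Y) k 1) :
    GeneralHodgePropertyFor (n + m) (X ⊗ Y) k 1 := by
  rw [generalHodgePropertyFor_tensor_iff_forall_inf_kunnethPiece_le' hX hY C k 1]
  intro i j hk
  rcases Nat.eq_zero_or_pos j with rfl | hj
  · obtain rfl : i = k := by omega
    exact h₁.le_supportedClasses_of_le_range_fst hX hY C (C.maxRatSubHodgeInFilt_inf_kunnethPiece_mem' hX hY hk 1)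
      (inf_le_right.trans (kunnethPiece_zero_right_eq_range hY i hk).le)
  rcases Nat.eq_zero_or_pos i with rfl | hi
  · obtain rfl : j = k := by omega
    exact h₂.le_supportedClasses_of_le_range_snd hX hY C (C.maxRatSubHodgeInFilt_inf_kunnethPiece_mem' hX hY hk 1)
      (inf_le_right.trans (kunnethPiece_zero_left_eq_range hX j hk).le)
  by_cases hin : n < i
  · exact inf_le_right.trans ((kunnethPiece_le_supportedClasses hX hY hk).trans (supportedClasses_mono _ _ (by omega)))
  by_cases hjm : m < j
  · exact inf_le_right.trans ((kunnethPiece_le_supportedClasses hX hY hk).trans (supportedClasses_mono _ _ (by omega)))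
  rcases h i j hk hi hj (not_lt.1 hin) (not_lt.1 hjm) with ha | hb | hle
  · exact inf_le_right.trans
      ((kunnethPiece_le_supportedClasses_of_eq_top_left hX hY hk ha).trans (supportedClasses_mono _ _ (by omega)))
  · exact inf_le_right.trans
      ((kunnethPiece_le_supportedClasses_of_eq_top_right hX hY hk hb).trans (supportedClasses_mono _ _ (by omega)))
  · exact hle

/-- **`GHC(X × Y, k, 1) ⟺ GHC(X, k, 1) ∧ GHC(Y, k, 1)` when every interior Künneth piece has a factor of geometric
coniveau `1`.** [cite: GrothendieckTopology1969, p. 300] [cite: Voisin2025, Introduction (journal p. 17) and §4.1]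
[cite: Arapura2006, §4 Lemma 4.2] -/
theorem generalHodgePropertyFor_tensor_level_one_iff_of_forall (hX : IsSmoothProjective n X)
    (hY : IsSmoothProjective m Y) {k : ℕ}
    (h : ∀ i j : ℕ, i + j = k → 0 < i → 0 < j → i ≤ n → j ≤ m →
      supportedClasses X i 1 = ⊤ ∨ supportedClasses Y j 1 = ⊤) :
    GeneralHodgePropertyFor (n + m) (X ⊗ Y) k 1 ↔
      GeneralHodgePropertyFor n X k 1 ∧ GeneralHodgePropertyFor m Y k 1 := by
  obtain ⟨C⟩ := nonempty_hodgeModel_holds (hX.tensor_holds hY)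
  refine ⟨fun hG ↦ ⟨generalHodgePropertyFor_of_tensor_left hX hY hG, generalHodgePropertyFor_of_tensor_right hX hY hG⟩,
    fun ⟨h₁, h₂⟩ ↦ generalHodgePropertyFor_tensor_level_one hX hY C h₁ h₂ fun i j hk hi hj hin hjm ↦ ?_⟩
  rcases h i j hk hi hj hin hjm with ha | hb
  · exact Or.inl ha
  · exact Or.inr (Or.inl hb)

/-! ### §3 Surfaces with `H¹ = 0` and `N¹ H² = H²` -/

/-- **For a smooth projective surface `S` with `H¹(S(ℂ); ℂ) = 0` and `N¹ H²(S) = H²(S)` (e.g. `q(S) = p_g(S) = 0`: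
Enriques surfaces, rational surfaces, …) and every smooth projective `Y`: `GHC(S × Y, k, 1) ⟺ GHC(Y, k, 1)`.**
The pieces `H¹(S) ⊗ H^{k−1}(Y)` vanish, `H²(S) ⊗ H^{k−2}(Y)` has a factor of coniveau `1`, `GHC(S, k, 1)` holds for
surfaces (`generalHodgePropertyFor_of_dim_le_two`), and §2. [cite: GrothendieckTopology1969, p. 300]
[cite: Voisin2025, Introduction (journal p. 17) and §4.1] [cite: Arapura2006, §4 Lemma 4.2] -/
theorem generalHodgePropertyFor_surface_tensor_level_one_iff {S : Motives.SchemeOver ℂ} (hS : IsSmoothProjective 2 S)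
    (hY : IsSmoothProjective m Y) [Subsingleton (complexBetti S 1)] (hS2 : supportedClasses S 2 1 = ⊤) (k : ℕ) :
    GeneralHodgePropertyFor (2 + m) (S ⊗ Y) k 1 ↔ GeneralHodgePropertyFor m Y k 1 := by
  obtain ⟨C⟩ := nonempty_hodgeModel_holds (hS.tensor_holds hY)
  refine ⟨fun hG ↦ generalHodgePropertyFor_of_tensor_right hS hY hG, fun h₂ ↦
    generalHodgePropertyFor_tensor_level_one hS hY C (generalHodgePropertyFor_of_dim_le_two le_rfl hS k 1) h₂
      fun i j hk hi _ hin _ ↦ ?_⟩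
  rcases (show i = 1 ∨ i = 2 by omega) with rfl | rfl
  · refine Or.inr (Or.inr ?_)
    rw [kunnethPiece_eq_bot_of_subsingleton_left hk, inf_bot_eq]
    exact bot_le
  · exact Or.inl hS2

/-! ### §4 Products with curves: the middle piece at level `1`; surfaces with `p_g = 0` times curves -/

/-- **`GHC(X × C, d + 2, 1) ⟺ max(X × C, d + 2, 1) ∩ (H^{d+1}(X) ⊗ H¹(C)) ⊆ N¹`** for `X` smooth projective of dimension
`d + 1` and `C` a smooth projective curve: in the prequel's `GHC(X × C, k + 2, r + 1) ⟺ GHC(X, k + 2, r + 1) ∧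
GHC(X, k, r) ∧ (middle component)` with `k = d`, `r = 0`, `GHC(X, d + 2, 1)` holds for free (`H^{d+2} = N¹ H^{d+2}` on
a `(d+1)`-fold, `generalHodgePropertyFor_of_dim_add_le`) and so does `GHC(X, d, 0)`.
[cite: GrothendieckTopology1969, p. 300] [cite: VoisinHodgeI2002, §11.3.3 Thm. 11.38, Thm. 11.40 and p. 287]
[cite: Voisin2025, §4.1 Def. 4.1] -/
theorem generalHodgePropertyFor_tensor_curve_middle_one_iff {d : ℕ} (hX : IsSmoothProjective (d + 1) X)
    (hC : IsSmoothProjective 1 Y) (C : HodgeModel (d + 1 + 1) (X ⊗ Y)) :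
    GeneralHodgePropertyFor (d + 1 + 1) (X ⊗ Y) (d + 2) 1 ↔
      C.maxRatSubHodgeInFilt (d + 2) 1 ⊓ kunnethPiece X Y (show (d + 1) + 1 = d + 2 by omega) ≤
        supportedClasses (X ⊗ Y) (d + 2) 1 := by
  obtain ⟨A⟩ := nonempty_hodgeModel_holds hX
  have h := generalHodgePropertyFor_tensor_curve_iff hX hC C d 0
  simp only [Nat.zero_add] at h
  rw [h]
  exact ⟨fun h' ↦ h'.2.2 (by omega),
    fun h' ↦ ⟨generalHodgePropertyFor_of_dim_add_le hX (by omega), generalHodgePropertyFor_zero A d, fun _ ↦ h'⟩⟩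

/-- **`N¹ H^{d+1}(X) = H^{d+1}(X)` gives `GHC(X × C, d + 2, 1)`** for every curve `C` (the middle piece
`H^{d+1}(X) ⊗ H¹(C)` then has a factor of coniveau `1`). [cite: GrothendieckTopology1969, p. 300]
[cite: Voisin2025, Introduction (journal p. 17) and §4.1] -/
theorem generalHodgePropertyFor_tensor_curve_middle_one_of_supportedClasses_eq_top {d : ℕ}
    (hX : IsSmoothProjective (d + 1) X) (hC : IsSmoothProjective 1 Y) (h : supportedClasses X (d + 1) 1 = ⊤) :
    GeneralHodgePropertyFor (d + 1 + 1) (X ⊗ Y) (d + 2) 1 := by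
  obtain ⟨C⟩ := nonempty_hodgeModel_holds (hX.tensor_holds hC)
  rw [generalHodgePropertyFor_tensor_curve_middle_one_iff hX hC C]
  exact inf_le_right.trans
    ((kunnethPiece_le_supportedClasses_of_eq_top_left hX hC _ h).trans (supportedClasses_mono _ _ (by omega)))

/-- **`GHC(S × C, 3, 1)` for a smooth projective surface `S` with `N¹ H²(S) = H²(S)` and a smooth projective curve `C`**
(the only bidegree of the threefold `S × C` not settled by Lefschetz `(1,1)`, hard Lefschetz and the trivial
cases; Murre §5.8.1). [cite: GrothendieckTopology1969, p. 300] [cite: MurreTorino1994, §5.8.1]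
[cite: Voisin2025, Introduction (journal p. 17)] -/
theorem generalHodgePropertyFor_surface_tensor_curve_three_one {S : Motives.SchemeOver ℂ}
    (hS : IsSmoothProjective 2 S) (hC : IsSmoothProjective 1 Y) (hS2 : supportedClasses S 2 1 = ⊤) :
    GeneralHodgePropertyFor 3 (S ⊗ Y) 3 1 :=
  generalHodgePropertyFor_tensor_curve_middle_one_of_supportedClasses_eq_top (d := 1) hS hC hS2

/-- **GROTHENDIECK'S AMENDED `GHC(S × C, i, r)` IN EVERY BIDEGREE for a surface `S` with `N¹ H²(S) = H²(S)` and a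
curve `C`**: the window of a threefold reduces to `(3, 1)` (`generalHodgePropertyFor_of_dim_three`: `(2, 1)`,
`(4, 2)` are Lefschetz `(1,1)` with hard Lefschetz, the rest is trivial). [cite: GrothendieckTopology1969, p. 300]
[cite: MurreTorino1994, §5.8.1] [cite: Voisin2025, Introduction (journal p. 17)] -/
theorem generalHodgePropertyFor_surface_tensor_curve {S : Motives.SchemeOver ℂ} (hS : IsSmoothProjective 2 S)
    (hC : IsSmoothProjective 1 Y) (hS2 : supportedClasses S 2 1 = ⊤) (i r : ℕ) :
    GeneralHodgePropertyFor 3 (S ⊗ Y) i r := by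
  by_cases h : i ≠ 3 ∨ r ≠ 1
  · exact generalHodgePropertyFor_of_dim_three (hS.tensor_holds hC) h
  · push Not at h
    obtain ⟨rfl, rfl⟩ := h
    exact generalHodgePropertyFor_surface_tensor_curve_three_one hS hC hS2

/-- **`p_g(S) = 0` gives `N¹ H²(S) = H²(S)`** for a smooth projective surface `S` (Lefschetz `(1,1)` = `GHC(S, 2, 1)`,
the tree's `generalHodgePropertyFor_two_one`, and «the vanishing of the spaces `H^{p,q}` for `p < c` or `q < c`
implies … geometric coniveau `≥ c`» granted `GHC`, the tree's
`GeneralHodgePropertyFor.supportedClasses_eq_top_of_hodgeNumber_eq_zero`; here `h^{0,2}(S) = p_g(S) = 0`).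
[cite: Voisin2025, Introduction (journal p. 17)] [cite: GrothendieckTopology1969, p. 300] -/
theorem supportedClasses_two_one_eq_top_of_hodgeNumber_zero_two {S : Motives.SchemeOver ℂ}
    (hHD : exists_isReal_hodgeModel) (hS : IsSmoothProjective 2 S)
    (h02 : (BettiUniverse.hodge hHD hS 2).hodgeNumber 0 2 = 0) : supportedClasses S 2 1 = ⊤ := by
  refine (generalHodgePropertyFor_two_one hS).supportedClasses_eq_top_of_hodgeNumber_eq_zero hHD hS
    fun p q hpq hp ↦ ?_
  obtain rfl : p = 0 := by omega
  obtain rfl : q = 2 := by omega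
  exact h02

/-- **`GHC(S × C, i, r)` in every bidegree for a surface `S` with `h^{2,0}(S) = 0` read in a Hodge model**
(`dim H^{2,0}(A) = 0` for some Hodge model `A` of `S`; `N¹ H²(S) = H²(S)` is then the tree's
`algebraicClasses_one_eq_top_of_hodgePQ_two_zero`). [cite: GrothendieckTopology1969, p. 300]
[cite: MurreTorino1994, §5.8.1] [cite: VoisinHodgeI2002, Thm. 11.30 and Thm. 6.18] -/
theorem forall_generalHodgePropertyFor_surface_tensor_curve_of_hodgePQ_two_zero {S : Motives.SchemeOver ℂ}
    (hS : IsSmoothProjective 2 S) (hC : IsSmoothProjective 1 Y)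
    (h20 : ∃ A : HodgeModel 2 S, Module.finrank ℂ ↥(A.hodgePQ 2 2 0) = 0) (i r : ℕ) :
    GeneralHodgePropertyFor 3 (S ⊗ Y) i r :=
  generalHodgePropertyFor_surface_tensor_curve hS hC (algebraicClasses_one_eq_top_of_hodgePQ_two_zero hS h20) i r

/-- **GROTHENDIECK'S AMENDED GENERALIZED HODGE CONJECTURE HOLDS IN EVERY BIDEGREE FOR `S × C`, `S` A SMOOTH
PROJECTIVE SURFACE WITH `p_g(S) = 0` (`h^{0,2}(S) = 0`), `C` A SMOOTH PROJECTIVE CURVE.** (By contrast, for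
`S = E × E'` a product of elliptic curves, `p_g = 1`, the piece `H²(S) ⊗ H¹(C)` carries Grothendieck's example.)
[cite: GrothendieckTopology1969, p. 300] [cite: MurreTorino1994, §5.8.1] [cite: Voisin2025, Introduction (journal p. 17)] -/
theorem forall_generalHodgePropertyFor_surface_tensor_curve_of_hodgeNumber_eq_zero {S : Motives.SchemeOver ℂ}
    (hHD : exists_isReal_hodgeModel) (hS : IsSmoothProjective 2 S) (hC : IsSmoothProjective 1 Y)
    (h02 : (BettiUniverse.hodge hHD hS 2).hodgeNumber 0 2 = 0) (i r : ℕ) :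
    GeneralHodgePropertyFor 3 (S ⊗ Y) i r :=
  generalHodgePropertyFor_surface_tensor_curve hS hC (supportedClasses_two_one_eq_top_of_hodgeNumber_zero_two hHD hS h02) i r

/-- **`GHC(S × Y, k, 1) ⟺ GHC(Y, k, 1)` for a surface `S` with `H¹(S(ℂ); ℂ) = 0` and `p_g(S) = 0`** and every smooth
projective `Y` (§3 with `N¹ H²(S) = H²(S)` from `h^{0,2}(S) = 0`). [cite: GrothendieckTopology1969, p. 300]
[cite: Voisin2025, Introduction (journal p. 17) and §4.1] [cite: Arapura2006, §4 Lemma 4.2] -/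
theorem generalHodgePropertyFor_surface_tensor_level_one_iff_of_hodgeNumber_eq_zero {S : Motives.SchemeOver ℂ}
    (hHD : exists_isReal_hodgeModel) (hS : IsSmoothProjective 2 S) (hY : IsSmoothProjective m Y)
    [Subsingleton (complexBetti S 1)] (h02 : (BettiUniverse.hodge hHD hS 2).hodgeNumber 0 2 = 0) (k : ℕ) :
    GeneralHodgePropertyFor (2 + m) (S ⊗ Y) k 1 ↔ GeneralHodgePropertyFor m Y k 1 :=
  generalHodgePropertyFor_surface_tensor_level_one_iff hS hY
    (supportedClasses_two_one_eq_top_of_hodgeNumber_zero_two hHD hS h02) k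

end Literature.AlgebraicGeometry.HodgeTheory

end
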